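import Summits.BirchSwinnertonDyer.BirchSwinnertonDyer.Theorems.GenusKolyvaginAtTwoGenusPrimitiveSupplyAtTwoDoorFieldSelmerBracket
import Literature.NumberTheory.EllipticCurves.TwoSelmerRankQuadraticParity
import Literature.NumberTheory.EllipticCurves.HeegnerHypothesisKroneckerProofs
import Literature.NumberTheory.EllipticCurves.ModularityVersionApProofs
import Literature.NumberTheory.EllipticCurves.BSDRankZeroDensity
import Literature.NumberTheory.QuadraticFields.QuadraticDedekindZeta
import HarnessLib

/-!
# Route `GenusKolyvaginAtTwo`, crux #2 `GenusPrimitiveSupplyAtTwo` (stmt-BirchSwinnertonDyer-22136):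
# THE PARITY BIT OVER THE DOOR FIELD — Kramer's parity (the tree's named fact
# `Monsky1996_lemma14b_twoSelmerRank_parity`) read at a door, and DESC-28-G′ BY NAME behind it

Width seat `bsd-line-gk2-p5` g18 (cell `bsd-f1-sign2`, SUPPLY lineage of crux 22136), file 52 of the series; sequel of file 51
(`#Sel₂(E_K/K) ∈ {4, 8}` at `ε = −1`, DESC-28-G′ up to one bit). THEOREMS ONLY (no definition, no new named fact, no `sorry`);
helper `--supports stmt-BirchSwinnertonDyer-22136`; no item is closed; BSD is not proved by any of this.

WHAT. REF1 §173-add/§173-add2 and REF2 v47 §9.5 located the «one bit» left open by file 51 (`#Ш(W_K/K)[2] ≠ 2` at a rank-`0` door):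
it is Kramer 1981 Thm. 1 (parity sentence) + Thm. 2 — in the tree VERBATIM as the named fact
`Literature.NumberTheory.EllipticCurves.Monsky1996_lemma14b_twoSelmerRank_parity` (`TwoSelmerRankQuadraticParity.lean`, the `h14` of
Monsky's `2`-parity theorem; NOT proved in the tree), to be INHABITED, not re-declared. This file does exactly that:

* §216 a door field `K` of `W` (`[K:ℚ] = 2`, `d_K` descent-admissible) satisfies the hypotheses of `h14`: `2` splits (`d_K ≡ 1 (8)`), every
  prime of `N_W` splits (`(d_K/ℓ) = 1` at odd bad `ℓ`), and `r₂(K) = 1` (`d_K < 0`):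
  `satisfiesHeegnerHypothesis_two_of_descAdmissible_discr`, `satisfiesHeegnerHypothesis_conductorNorm_of_descAdmissible_discr`,
  `nrComplexPlaces_eq_one_of_descAdmissible_discr`.
* §217 the descent count over `K` in `h14`'s currency: `#Sel₂(W_K/K) = 2^(rank W(K) + u)` with `#Ш(W_K/K)[2] = 2^u` when `E(ℚ)[2] = 0`
  (`natCard_selmerGroup_baseChange_two_eq_two_pow_add`), `∃ u, #Ш(W_K/K)[2] = 2^u` (`exists_natCard_sha_torsionBy_two_eq_two_pow`), and,
  BEHIND `h14`: `rank W(K) + u` is ODD at a door (`mordellWeilRank_baseChange_add_mod_two_eq_one_of_monsky`), hence **`#Sel₂(W_K/K)` is an ODD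
  power of `2`, never a square** (`not_isSquare_natCard_selmerGroup_baseChange_two_of_monsky`,
  `not_isSquare_fieldSelmerTwoCard_of_monsky`) — the parity clause «`k` odd» of -desc's DESC-29-M `DoorFieldSelmerBoundsAtTwo` at ANY door.
* §218 **DESC-28-G′ BY NAME behind `h14`**: `identityGeneratorDoorFieldSelmerCardAtTwo_of_monsky :
  Monsky1996_lemma14b_twoSelmerRank_parity → F1Sign2.IdentityGeneratorDoorFieldSelmerCardAtTwo` — file 51 gives `#Sel₂(W/K) ∈ {4, 8}`, §217
  says it is an odd power of `2`, so it is `8`; in `Ш`-currency at a rank-`0` door `#Ш(W_K/K)[2] = 4`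
  (`natCard_sha_two_baseChange_eq_four_of_not_meetsEgg_of_monsky`).

Honest framing: CONDITIONAL on the displayed named fact `h14` (Kramer 1981 Thm. 1 + Thm. 2 as Monsky's Lemma 1.4(b); a `conditional-result`
in the gate's sense); everything else is kernel bookkeeping over files 47–51. Discharging `h14` itself (= Kramer's Theorem 2: the sum of the
two Cassels–Tate forms is a perfect alternating duality on `Φ/NS′`) needs global Poitou–Tate duality for the `2`-Selmer structure and is NOT done
here. Crux 22136 stays OPEN exactly at (U) 24947 ∧ (CONV₂) 19220/24948. BSD is not proved by any of this.

References: [Kramer1981] Thm. 1, Thm. 2, Prop. 3, Prop. 6; [Monsky1996] Lemma 1.4(b); [Marcus2018] Ch. 3 Thm. 25; [SilvermanAEC2009] Thm X.4.2.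
-/

set_option linter.dupNamespace false -- tree convention: `Summit.BirchSwinnertonDyer.BirchSwinnertonDyer.Theorems` (summit = sub-problem)
set_option autoImplicit false

noncomputable section

open scoped Classical AddSubgroup

namespace Summit.BirchSwinnertonDyer.BirchSwinnertonDyer.Theorems.GenusKolyArch

open WeierstrassCurve NumberField NumberField.InfinitePlace Field
open Literature.NumberTheory.EllipticCurves
open Summit.BirchSwinnertonDyer.Rank1Residual.F1Sign2 (DescAdmissible NoRationalTwoTorsion ShaTwoTrivial MeetsEgg shaTwoCard
  IsDoorField fieldSelmerTwoCard doorTwist)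

/-! ## §216 A door field satisfies the hypotheses of `h14` -/

section DoorHypotheses

variable (W : WeierstrassCurve ℚ) [W.IsElliptic] [W.IsGloballyMinimal] (K : Type) [Field K] [NumberField K]

omit [W.IsElliptic] in
/-- **`2` splits in a door field**: `d_K ≡ 1 (mod 8)` (decomposition law, tree `satisfiesHeegnerHypothesis_iff_kronecker`).
[cite: Marcus2018, Ch. 3 Thm. 25] -/
theorem satisfiesHeegnerHypothesis_two_of_descAdmissible_discr (h2 : Module.finrank ℚ K = 2)
    (hd : DescAdmissible W (NumberField.discr K)) : SatisfiesHeegnerHypothesis 2 K := by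
  rw [satisfiesHeegnerHypothesis_iff_kronecker 2 K h2]
  intro p hp hp2
  have hp2' : p = 2 := (Nat.prime_dvd_prime_iff_eq hp Nat.prime_two).mp hp2
  exact ⟨fun _ ↦ hd.2.2.1, fun h ↦ absurd hp2' h⟩

/-- **Every prime of the conductor splits in a door field**: `2` by `d_K ≡ 1 (mod 8)`, an odd bad `ℓ` by the admissibility clause
`(d_K/ℓ) = 1` (`p ∣ N_W ⟺` bad reduction, tree `dvd_conductorNorm_iff_not_hasGoodReductionAtPrime`). [cite: Marcus2018, Ch. 3 Thm. 25]
[cite: GrossLMS1991, §1] -/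
theorem satisfiesHeegnerHypothesis_conductorNorm_of_descAdmissible_discr (h2 : Module.finrank ℚ K = 2)
    (hd : DescAdmissible W (NumberField.discr K)) : SatisfiesHeegnerHypothesis (W.conductorNorm ℤ) K := by
  rw [satisfiesHeegnerHypothesis_iff_kronecker _ K h2]
  intro p hp hpN
  haveI : Fact p.Prime := ⟨hp⟩
  have hbadp : ¬ W.HasGoodReductionAtPrime p := (W.dvd_conductorNorm_iff_not_hasGoodReductionAtPrime p).mp hpN
  exact ⟨fun _ ↦ hd.2.2.1, fun hp2 ↦ hd.2.2.2.2 p hp hp2 fun _ ↦ hbadp⟩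

omit [W.IsElliptic] in
/-- **A door field has exactly one complex place** (`d_K < 0`, `[K:ℚ] = 2`). [folklore] -/
theorem nrComplexPlaces_eq_one_of_descAdmissible_discr (h2 : Module.finrank ℚ K = 2)
    (hd : DescAdmissible W (NumberField.discr K)) : nrComplexPlaces K = 1 :=
  (Literature.NumberTheory.QuadraticFields.Quadratic.nrRealPlaces_eq_zero_and_nrComplexPlaces_eq_one h2 hd.1).2

end DoorHypotheses

/-! ## §217 The descent count over `K` in `h14`'s currency; the parity bit behind `h14` -/

section Parity

variable (W : WeierstrassCurve ℚ) [W.IsElliptic] [W.IsGloballyMinimal] (K : Type) [Field K] [NumberField K]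

omit [W.IsElliptic] [W.IsGloballyMinimal] in
/-- Bookkeeping: the two spellings of `#Ш(W_K/K)[2]` agree — `Ш ⊓ H¹(K,E)[2]` counted in `H¹` (files 50/51) vs. the `2`-torsion subgroup of
the type `Ш` (the currency of `h14`). [folklore] -/
theorem natCard_sha_inf_torsionBy_two_eq_natCard_sha_torsionBy_two :
    Nat.card ((W.baseChange K).sha ⊓ AddSubgroup.torsionBy (W.baseChange K).galH1 ((2 : ℕ) : ℕ) : AddSubgroup _) =
      Nat.card (((W.baseChange K).sha)[(2 : ℤ)]) := by
  have h := natCard_sha_inf_torsionBy_eq (W.baseChange K) 2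
  simpa using h

omit [W.IsGloballyMinimal] in
/-- **The descent count over `K`**: `#Sel₂(W_K/K) = 2^(rank W(K) + u)` when `#Ш(W_K/K)[2] = 2^u` and `E(ℚ)[2] = 0` (so `E(K)[2] = 0` for
`K` quadratic). [cite: SilvermanAEC2009, Thm X.4.2(a) and VIII.6] -/
theorem natCard_selmerGroup_baseChange_two_eq_two_pow_add (hT : NoRationalTwoTorsion W) (h2 : Module.finrank ℚ K = 2) {u : ℕ}
    (hu : Nat.card (((W.baseChange K).sha)[(2 : ℤ)]) = 2 ^ u) :
    Nat.card ((W.baseChange K).selmerGroup ((2 : ℕ) : ℤ)) = 2 ^ ((W.baseChange K).mordellWeilRank + u) := by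
  haveI : (W.baseChange K).IsElliptic := inferInstanceAs ((W.map (algebraMap ℚ K)).IsElliptic)
  have h := card_selmerGroup_eq_pow_rank_mul (W.baseChange K) 2
  rw [natCard_torsionBy_two_baseChange_eq_one W K hT h2, mul_one, natCard_sha_inf_torsionBy_two_eq_natCard_sha_torsionBy_two W K,
    hu, ← pow_add] at h
  exact h

omit [W.IsGloballyMinimal] in
/-- **`#Ш(W_K/K)[2]` is a power of `2`**: it divides `#Sel₂(W_K/K)`, a power of `2` (tree `exists_natCard_selmerGroup_eq_pow`), by the descent
count. [cite: SilvermanAEC2009, Thm X.4.2] -/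
theorem exists_natCard_sha_torsionBy_two_eq_two_pow :
    ∃ u : ℕ, Nat.card (((W.baseChange K).sha)[(2 : ℤ)]) = 2 ^ u := by
  haveI : (W.baseChange K).IsElliptic := inferInstanceAs ((W.map (algebraMap ℚ K)).IsElliptic)
  haveI : Fact (Nat.Prime 2) := ⟨Nat.prime_two⟩
  obtain ⟨s, hs⟩ := exists_natCard_selmerGroup_eq_pow (W.baseChange K) 2
  have h := card_selmerGroup_eq_pow_rank_mul (W.baseChange K) 2
  rw [hs, natCard_sha_inf_torsionBy_two_eq_natCard_sha_torsionBy_two W K] at h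
  have hdvd : Nat.card (((W.baseChange K).sha)[(2 : ℤ)]) ∣ 2 ^ s := Dvd.intro_left _ h.symm
  obtain ⟨u, -, hu⟩ := (Nat.dvd_prime_pow Nat.prime_two).mp hdvd
  exact ⟨u, hu⟩

/-- **The parity bit at a door, behind `h14`** (Kramer 1981 Thm. 1 + Thm. 2 = Monsky 1996 Lemma 1.4(b), the tree's named fact
`Monsky1996_lemma14b_twoSelmerRank_parity`, NOT proved here): for `K` a door field of `W` (`[K:ℚ] = 2`, `d_K` descent-admissible) and
`#Ш(W_K/K)[2] = 2^u`, `rank W(K) + u` is ODD (`= r₂(K) = 1` modulo `2`). CONDITIONAL on `h14`. [cite: Kramer1981, Thm. 1, Thm. 2]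
[cite: Monsky1996, Lemma 1.4(b)] -/
theorem mordellWeilRank_baseChange_add_mod_two_eq_one_of_monsky (h14 : Monsky1996_lemma14b_twoSelmerRank_parity)
    (h2 : Module.finrank ℚ K = 2) (hd : DescAdmissible W (NumberField.discr K)) {u : ℕ}
    (hu : Nat.card (((W.baseChange K).sha)[(2 : ℤ)]) = 2 ^ u) :
    ((W.baseChange K).mordellWeilRank + u) % 2 = 1 := by
  have h := h14 W K h2 (satisfiesHeegnerHypothesis_two_of_descAdmissible_discr W K h2 hd)
    (satisfiesHeegnerHypothesis_conductorNorm_of_descAdmissible_discr W K h2 hd) u hu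
  rwa [nrComplexPlaces_eq_one_of_descAdmissible_discr W K h2 hd] at h

/-- **`#Sel₂(W_K/K)` is an odd power of `2` at a door, behind `h14`** (`E(ℚ)[2] = 0`): `#Sel₂(W_K/K) = 2^(rank W(K) + u)` with
`rank W(K) + u` odd. CONDITIONAL on `h14`. [cite: Kramer1981, Thm. 1, Thm. 2] -/
theorem exists_natCard_selmerGroup_baseChange_two_eq_two_pow_odd_of_monsky (h14 : Monsky1996_lemma14b_twoSelmerRank_parity)
    (hT : NoRationalTwoTorsion W) (h2 : Module.finrank ℚ K = 2) (hd : DescAdmissible W (NumberField.discr K)) :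
    ∃ k : ℕ, Nat.card ((W.baseChange K).selmerGroup ((2 : ℕ) : ℤ)) = 2 ^ k ∧ k % 2 = 1 := by
  obtain ⟨u, hu⟩ := exists_natCard_sha_torsionBy_two_eq_two_pow W K
  exact ⟨_, natCard_selmerGroup_baseChange_two_eq_two_pow_add W K hT h2 hu,
    mordellWeilRank_baseChange_add_mod_two_eq_one_of_monsky W K h14 h2 hd hu⟩

/-- An odd power of `2` is not a square. [folklore] -/
theorem not_isSquare_two_pow_of_mod_two_eq_one {k : ℕ} (hk : k % 2 = 1) : ¬ IsSquare (2 ^ k) := by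
  rintro ⟨r, hr⟩
  have hfac : (2 ^ k).factorization 2 = k := by
    rw [Nat.Prime.factorization_pow Nat.prime_two, Finsupp.single_eq_same]
  have hr0 : r ≠ 0 := by
    rintro rfl
    simp at hr
  have hsq : (r * r).factorization 2 = 2 * r.factorization 2 := by
    rw [Nat.factorization_mul hr0 hr0, Finsupp.add_apply, two_mul]
  rw [← hr, hfac] at hsq
  omega

/-- **DESC-29-M's parity clause, behind `h14`: `#Sel₂(W_K/K)` is NOT a square at a door** (`dim_𝔽₂ Sel₂(W/K_d)` is odd) for `W` with
`E(ℚ)[2] = 0`. CONDITIONAL on `h14`. [cite: Kramer1981, Thm. 1, Thm. 2] [cite: Monsky1996, Lemma 1.4(b)] -/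
theorem not_isSquare_natCard_selmerGroup_baseChange_two_of_monsky (h14 : Monsky1996_lemma14b_twoSelmerRank_parity)
    (hT : NoRationalTwoTorsion W) (h2 : Module.finrank ℚ K = 2) (hd : DescAdmissible W (NumberField.discr K)) :
    ¬ IsSquare (Nat.card ((W.baseChange K).selmerGroup ((2 : ℕ) : ℤ))) := by
  obtain ⟨k, hk, hk1⟩ := exists_natCard_selmerGroup_baseChange_two_eq_two_pow_odd_of_monsky W K h14 hT h2 hd
  rw [hk]
  exact not_isSquare_two_pow_of_mod_two_eq_one hk1

/-- **DESC-29-M's parity clause in the cell's currency, behind `h14`**: `¬ IsSquare (fieldSelmerTwoCard W K)` for `K` a door field of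
`W`, `E(ℚ)[2] = 0`. CONDITIONAL on `h14`. [cite: Kramer1981, Thm. 1, Thm. 2] -/
theorem not_isSquare_fieldSelmerTwoCard_of_monsky (h14 : Monsky1996_lemma14b_twoSelmerRank_parity)
    (hT : NoRationalTwoTorsion W) (hK : IsDoorField W K) : ¬ IsSquare (fieldSelmerTwoCard W K) :=
  not_isSquare_natCard_selmerGroup_baseChange_two_of_monsky W K h14 hT hK.1 hK.2

end Parity

/-! ## §218 DESC-28-G′ `F1Sign2.IdentityGeneratorDoorFieldSelmerCardAtTwo` BY NAME behind `h14` -/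

section DoorFieldPrime

variable (W : WeierstrassCurve ℚ) [W.IsElliptic] [W.IsGloballyMinimal] (K : Type) [Field K] [NumberField K]

/-- **`ε(E) = −1 ⟹ #Sel₂(E_K/K) = 8` over a door field, behind `h14`**: file 51 gives `#Sel₂(E_K/K) ∈ {4, 8}` (`Δ > 0`, `E(ℚ)[2] = 0`, rank
one, `Ш(E)[2] = 0`, `E(ℚ) ⊂ E⁰(ℝ)`, `d_K` descent-admissible; NO twist-rank or finiteness hypothesis), and §217 says `#Sel₂(E_K/K)` is an odd power
of `2`; so it is `8`. CONDITIONAL on `h14`. [cite: Kramer1981, Thm. 1, Prop. 7, Thm. 2] -/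
theorem natCard_selmerGroup_baseChange_two_eq_eight_of_not_meetsEgg_of_monsky (h14 : Monsky1996_lemma14b_twoSelmerRank_parity)
    (hΔ : 0 < W.Δ) (hT : NoRationalTwoTorsion W) (hrank : W.mordellWeilRank = 1) (hSha : ShaTwoTrivial W) (hegg : ¬ MeetsEgg W)
    (h2 : Module.finrank ℚ K = 2) (hd : DescAdmissible W (NumberField.discr K)) :
    Nat.card ((W.baseChange K).selmerGroup ((2 : ℕ) : ℤ)) = 8 := by
  obtain ⟨i, -, hi⟩ := exists_sq_eq_discr_not_mem_range K h2
  have hi' : i ^ 2 = ((NumberField.discr K : ℤ) : K) := by rw [hi, map_intCast]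
  obtain ⟨k, hk, hk1⟩ := exists_natCard_selmerGroup_baseChange_two_eq_two_pow_odd_of_monsky W K h14 hT h2 hd
  rcases natCard_selmerGroup_baseChange_two_eq_four_or_eq_eight_of_not_meetsEgg W K hΔ hT hrank hSha hegg hd h2 hi' with h | h
  · exfalso
    rw [hk] at h
    have hk2 : k = 2 := by
      have h4 : (2 : ℕ) ^ k = 2 ^ 2 := by rw [h]; norm_num
      exact Nat.pow_right_injective le_rfl h4
    omega
  · exact h

/-- **`ε(E) = −1` at a rank-`0` door, behind `h14`: `#Ш(E_K/K)[2] = 4`** — the bit file 51 left open (`∈ {2, 4}` unconditionally, `4` under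
finiteness); here from parity instead of finiteness. CONDITIONAL on `h14`. [cite: Kramer1981, Thm. 1, Thm. 2] -/
theorem natCard_sha_two_baseChange_eq_four_of_not_meetsEgg_of_monsky (h14 : Monsky1996_lemma14b_twoSelmerRank_parity)
    (hΔ : 0 < W.Δ) (hT : NoRationalTwoTorsion W) (hrank : W.mordellWeilRank = 1) (hSha : ShaTwoTrivial W) (hegg : ¬ MeetsEgg W)
    (h2 : Module.finrank ℚ K = 2) (hd : DescAdmissible W (NumberField.discr K))
    (hrank0 : (W.quadraticTwist ((NumberField.discr K : ℤ) : ℚ)).mordellWeilRank = 0) :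
    Nat.card ((W.baseChange K).sha ⊓ AddSubgroup.torsionBy (W.baseChange K).galH1 ((2 : ℕ) : ℕ) : AddSubgroup _) = 4 := by
  obtain ⟨i, -, hi⟩ := exists_sq_eq_discr_not_mem_range K h2
  have hi' : i ^ 2 = ((NumberField.discr K : ℤ) : K) := by rw [hi, map_intCast]
  have hmul := natCard_selmerGroup_baseChange_two_eq_two_mul W K hT h2 (mordellWeilRank_baseChange_eq_one W K hrank hd.1 hrank0 h2 hi')
  rw [natCard_selmerGroup_baseChange_two_eq_eight_of_not_meetsEgg_of_monsky W K h14 hΔ hT hrank hSha hegg h2 hd] at hmul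
  omega

/-- **DESC-28-G′ BY NAME, behind `h14`**: `Monsky1996_lemma14b_twoSelmerRank_parity → F1Sign2.IdentityGeneratorDoorFieldSelmerCardAtTwo` —
under the row's exact hypotheses (`Δ_W > 0`, `E(ℚ)[2] = 0`, rank one, `#Ш(W)[2] = 1`, NO rational point on the egg, `K` a door field):
`#Sel₂(W/K) = 8`. The only input beyond files 47–51 is the parity sentence of Kramer 1981 Thm. 1 (with Thm. 2), taken as the tree's existing named
fact (REF1 §173-add2 / REF2 v47 §9.5: inhabit, do not re-declare). CONDITIONAL on `h14`; BSD is not proved by this.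
[cite: Kramer1981, Thm. 1, Prop. 7, Thm. 2] [cite: Monsky1996, Lemma 1.4(b)] -/
theorem identityGeneratorDoorFieldSelmerCardAtTwo_of_monsky (h14 : Monsky1996_lemma14b_twoSelmerRank_parity) :
    Summit.BirchSwinnertonDyer.Rank1Residual.F1Sign2.IdentityGeneratorDoorFieldSelmerCardAtTwo := by
  intro W _ _ hΔ hT hrank hSha1 hegg K _ _ hK
  exact natCard_selmerGroup_baseChange_two_eq_eight_of_not_meetsEgg_of_monsky W K h14 hΔ hT hrank
    (shaTwoTrivial_of_shaTwoCard_eq_one W hSha1) hegg hK.1 hK.2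

end DoorFieldPrime

end Summit.BirchSwinnertonDyer.BirchSwinnertonDyer.Theorems.GenusKolyArch

end
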